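import Summits.BirchSwinnertonDyer.BirchSwinnertonDyer.Theorems.PrintCf2RubinValueTwoEllipticUnitsPrincipalTwo
import Literature.NumberTheory.EllipticCurves.PAdicTwoVariableColemanImageMulRule
import HarnessLib

/-!
# Brick (c) at `p = 2`: the two-variable elliptic units of a NON-LIFTABLE class through the Coleman transform — for `𝔞` with a local Artin
# lift `σ̃_𝔞` and an ARBITRARY `𝔠`: `Σ Col ⟨e(𝔞𝔠)⟩ = σ_{χ(σ̃_𝔞)}(C g_𝔞 • Σ Col ⟨e(𝔠)⟩) + N𝔠 • Σ Col ⟨e(𝔞)⟩` and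
# `φ_ε(Σ Col ⟨e(𝔞𝔠)⟩) = (t_𝔞·C g_𝔞)·φ_ε(Σ Col ⟨e(𝔠)⟩) + N𝔠·φ_ε(Σ Col ⟨e(𝔞)⟩)` (de Shalit II.2.4 (ii), II.4.12 with `i` SEMI-local, III.1.3–1.4)

Cell `bsd-print-cf2`, width seat `bsd-line-cf2c-w7` g21, route C `PrintCf2RubinValueTwo`, crux of record stmt-BirchSwinnertonDyer-24033
`TwoVariableMainConjAtSplitTwoQuad` (23720 nominal), BRICK §4(c); `--supports` the crux as a helper.  THEOREMS ONLY (0 sorry, no named fact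
asserted, no definition); CONDITIONAL on the published named facts `DeShalit1987.prop24_ii_galoisAction` (II.2.4 (ii)), `prop24_iii_unit`,
`prop25_i_normRelation` carried as hypotheses by the elliptic-unit files.  Theses-free.  BSD is not proved by any of this.

WHY (memo BRICK-C-PADIC-g20, findings F26/F26′/F26″).  The (c)-capstone T15 computes, at ONE prime `𝔓 ∣ v` of de Shalit's two-variable tower,
`char_Λ((N_Σ/Col_Σ 𝒞̄_ell)_ε) = (L_ε)` for the closure `𝒞̄_ell` of the elliptic units `⟨e(𝔞)⟩` with `𝔞` LIFTABLE (Artin symbol in the decomposition group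
`D` of `𝔓`; `IsLocArtinLiftable`), `L_ε` being pinned by `φ_ε(Σ Col ⟨e(𝔞)⟩) = (t_𝔞·C g_𝔞 − N𝔞)·L_ε`.  The SEMI-local module `U_∞/𝒞̄` of the LEAD's frame
(`SemilocalUnitData₂`, Rubin's `𝒞̄` = closure of ALL elliptic units) sees at `𝔓`, after Shapiro, the `𝔓`-components `e(𝔠)_𝔓` for EVERY `𝔠` — and for
`K = ℚ(√−7)`, `𝔤 = (√−7)v̄³` the liftable classes have index `[G:D] = 2`.  By II.2.4 (ii) in the form `σ̃_𝔞·⟨e(𝔠)⟩ · ⟨e(𝔞)⟩^{N𝔠} = ⟨e(𝔞𝔠)⟩`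
(`galAct_ellipticUnitsPrincipal₂_mul_pow`, which needs a local lift for `𝔞` ONLY), the Coleman images of the non-liftable units are governed by the
liftable data plus ONE new constant per coset.  THIS file instantiates the generic one-sided mul-rule file
(`Literature/…/PAdicTwoVariableColemanImageMulRule`) on the elliptic units, in the generality of `PrintCf2RubinValueTwoEllipticUnitsPrincipalTwo`
(arbitrary totally complex `K`, conductor `𝔤`, auxiliary prime `v' ≠ v`, unramified offset `c`; the coherence certificates of the three families are
free arguments, so the (e)-assembler may pass T15's own certificate terms):

* ★★ `colemanImage_ellipticUnitsPrincipal₂_mul_eq` — `Col ⟨e(𝔞𝔠)⟩ = galOpₗ (χ_π σ̃_𝔞) g s (Col ⟨e(𝔠)⟩) + C(N𝔠) • Col ⟨e(𝔞)⟩` in `M = M₁^{ℤ/d}`;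
* ★★★ **`indexTraceₗ_colemanImage_ellipticUnitsPrincipal₂_mul_eq`** — **`Σ Col ⟨e(𝔞𝔠)⟩ = σ_{χ_π σ̃_𝔞}(C g • Σ Col ⟨e(𝔠)⟩) + C(N𝔠) • Σ Col ⟨e(𝔞)⟩`**;
* ★★★ **`colemanDeltaCoinvFun_indexTraceₗ_colemanImage_ellipticUnitsPrincipal₂_mul_eq`** —
  **`φ_ε(Σ Col ⟨e(𝔞𝔠)⟩) = (t_{χσ̃_𝔞}·C g)·φ_ε(Σ Col ⟨e(𝔠)⟩) + C(N𝔠)·φ_ε(Σ Col ⟨e(𝔞)⟩)`**;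
* ★★★ `colemanDeltaCoinvFun_indexTraceₗ_colemanImage_ellipticUnitsPrincipal₂_mul_eq_of_eq_mul` — given the capstone's value
  `φ_ε(Σ Col ⟨e(𝔞)⟩) = (t_{χσ̃_𝔞}·C g − C(N𝔞))·L`: **`φ_ε(Σ Col ⟨e(𝔞𝔠)⟩) = (t·C g)·φ_ε(Σ Col ⟨e(𝔠)⟩) + C(N𝔠)·(t·C g − C(N𝔞))·L`**, and the
  conjugate-cocycle form `φ_ε(Σ Col ⟨e(𝔞𝔠)⟩ − C(N𝔞) • Σ Col ⟨e(𝔠)⟩) = (t·C g − C(N𝔞))·(C(N𝔠)·L + φ_ε(Σ Col ⟨e(𝔠)⟩))` (`…_sub_smul_eq`: the constant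
  of the conjugate family `(σ_𝔠 e(𝔞))_𝔓` is `L′ = N𝔠·L + φ_ε(Σ Col ⟨e(𝔠)⟩)` — de Shalit's second coset component `μ_τ`, `τ = σ_𝔠 D`).

## References
* [deShalit1987] E. de Shalit, *Iwasawa theory of elliptic curves with complex multiplication* (1987), II.2.4 (ii) (p. 45), II.4.12 (29)–(33)
  (p. 66–67), II.4.14 Step 1 (p. 71), III.1.3–1.4 (5) (p. 89–91); I §3.1, §3.4 Lemma (ii), §3.8 (17).
* [SerreLocalFields1979] J.-P. Serre, *Local Fields* (1979), Ch. II §4 Prop. 8.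
-/

-- the summit namespace `Summit.BirchSwinnertonDyer.BirchSwinnertonDyer` repeats the problem name by design (D-0017)
set_option linter.dupNamespace false
set_option autoImplicit false

noncomputable section

open scoped Classical
open scoped NumberField
open Field IsDedekindDomain IsDedekindDomain.HeightOneSpectrum ValuativeRel
open Literature.NumberTheory.NumberFields
open Literature.NumberTheory.GaloisRepresentations Literature.NumberTheory.GaloisRepresentations.IsNonarchimedeanLocalField
  Literature.NumberTheory.GaloisRepresentations.LubinTate Literature.NumberTheory.GaloisRepresentations.ArtinLocalGlobal
open Literature.NumberTheory.EllipticCurves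
open Literature.NumberTheory.ComplexMultiplication.EllipticUnits
open Literature.NumberTheory.LFunctions.AbelianDensity (artinSymbol)
open Summit.BirchSwinnertonDyer.BirchSwinnertonDyer.Theorems.PrintCf2.EllipticUnitsLocal
open Summit.BirchSwinnertonDyer.BirchSwinnertonDyer.Theorems.PrintCf2.EllipticUnitsLocal₂

namespace Summit.BirchSwinnertonDyer.BirchSwinnertonDyer.Theorems.PrintCf2.EllipticUnitsMulRuleColeman

variable {K : Type} [Field K] [NumberField K] {𝔤 : Ideal (𝓞 K)} {v v' : HeightOneSpectrum (𝓞 K)}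

attribute [local instance] ltNormUniformSpace ltNormIsUniformAddGroup rk1 nF nE fintypeResidueField
attribute [local instance] RelNormCoherentUnits.instCommMonoid

variable [NumberField.IsTotallyComplex K]
  (h24iii : DeShalit1987.prop24_iii_unit) (h25 : DeShalit1987.prop25_i_normRelation) (h24ii : DeShalit1987.prop24_ii_galoisAction)
  (hK : IsImaginaryQuadratic K) (ι : K →+* ℂ)
  (h𝔤0 : 𝔤 ≠ ⊥) (hv : ¬ 𝔤 ≤ v.asIdeal) (hvv' : v' ≠ v) (hw : ∀ u : (𝓞 K)ˣ, (u : 𝓞 K) - 1 ∈ 𝔤 * v'.asIdeal → u = 1)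
  {π : 𝒪[v.adicCompletion K]} (hπ : (valuation (v.adicCompletion K)).IsUniformizer (π : v.adicCompletion K))
  {α : ℕ → 𝓞 K} (hα0 : ∀ i, α i ≠ 0) (hα𝔪 : ∀ i, α i - 1 ∈ 𝔤 * v'.asIdeal ^ (i + 1))
  (hαw : ∀ i, ∀ w : HeightOneSpectrum (𝓞 K), w ≠ v → α i ∉ w.asIdeal)
  {f : ℕ → ℕ} (hαπ : ∀ i, ((α i : K) : v.adicCompletion K) = (π : v.adicCompletion K) ^ f i)
  [CharZero (v.adicCompletion K)]
  -- the local two-variable tower and the Coleman frame at `q = 2`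
  {p : ℕ} [hp : Fact p.Prime] {d : ℕ} (hd : d.Coprime p)
  (E : ℕ → IntermediateField (v.adicCompletion K) (AlgebraicClosure (v.adicCompletion K)))
  [∀ j, FiniteDimensional (v.adicCompletion K) (E j)] [∀ j, Normal (v.adicCompletion K) (E j)] [∀ j, IsGalois (v.adicCompletion K) (E j)]
  (hmono : Monotone E) (hE : ∀ j, E j ≤ maxUnramified (v.adicCompletion K)) (hdeg : ∀ j, Module.finrank (v.adicCompletion K) (E j) = d * p ^ j)
  {σ₀ : absoluteGaloisGroup (v.adicCompletion K)} (hσ₀ : IsAbsArithFrob σ₀) (hq : residueFieldCard (v.adicCompletion K) = 2)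
  (u : (LTCoeff (v.adicCompletion K))ˣ) (hu : LTCoeff.of (v.adicCompletion K) π = residueFieldCard (v.adicCompletion K) * u)
  (γ w : 𝒪[v.adicCompletion K]ˣ) (hγ : (γ : 𝒪[v.adicCompletion K]) = 1 + π ^ 2 * w)
  [IsAdicComplete (Ideal.span {intBase (v.adicCompletion K) (LTCoeff.of (v.adicCompletion K) π)}) (PowerSeries 𝒪[v.adicCompletion K])]
  [NeZero d]
  {θ : ∀ j, unitBall (E j)} (hθ : ∀ j, IsIntegralNormalGen (E j) (θ j))
  (hcoh : ∀ j, unitBallTrace (hmono (Nat.le_succ j)) (θ (j + 1)) = θ j)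
  [IsAdicComplete (Ideal.span {(p : 𝒪[v.adicCompletion K])}) 𝒪[v.adicCompletion K]]
  (ε : PowerSeries (PowerSeries 𝒪[v.adicCompletion K])) (hε : ε * ε = 1)
  -- the unramified offset and the Weil-degree data on the shifted levels
  (c : ℕ)
  (hdegE : ∀ i, ∀ w' : WeilGroup (v.adicCompletion K),
    WeilGroup.toAbsGalois (v.adicCompletion K) w' ∈ (E (i + c)).fixingSubgroup → (f i : ℤ) ∣ WeilGroup.deg w')
  -- the two ideals: `𝔞` (with a local Artin lift) and `𝔠` (arbitrary)
  {𝔞 𝔠 : Ideal (𝓞 K)} (h𝔞0 : 𝔞 ≠ ⊥) (h𝔞c : IsCoprime 𝔞 (𝔤 * v.asIdeal * v'.asIdeal))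
  (h𝔠0 : 𝔠 ≠ ⊥) (h𝔠c : IsCoprime 𝔠 (𝔤 * v.asIdeal * v'.asIdeal)) (h𝔞𝔠c : IsCoprime (𝔞 * 𝔠) (𝔤 * v.asIdeal * v'.asIdeal))
  (xa : ∀ i k : ℕ, rayClassField K (𝔤 * v'.asIdeal ^ (i + 1) * v.asIdeal ^ (k + 1)))
  (hxa : ∀ i k : ℕ, IsThetaValueOne ι (𝔤 * v'.asIdeal ^ (i + 1) * v.asIdeal ^ (k + 1)) 𝔞
    (algClosureEmb ι ((xa i k : rayClassField K (𝔤 * v'.asIdeal ^ (i + 1) * v.asIdeal ^ (k + 1))) : AlgebraicClosure K)))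
  (xc : ∀ i k : ℕ, rayClassField K (𝔤 * v'.asIdeal ^ (i + 1) * v.asIdeal ^ (k + 1)))
  (hxc : ∀ i k : ℕ, IsThetaValueOne ι (𝔤 * v'.asIdeal ^ (i + 1) * v.asIdeal ^ (k + 1)) 𝔠
    (algClosureEmb ι ((xc i k : rayClassField K (𝔤 * v'.asIdeal ^ (i + 1) * v.asIdeal ^ (k + 1))) : AlgebraicClosure K)))
  (xac : ∀ i k : ℕ, rayClassField K (𝔤 * v'.asIdeal ^ (i + 1) * v.asIdeal ^ (k + 1)))
  (hxac : ∀ i k : ℕ, IsThetaValueOne ι (𝔤 * v'.asIdeal ^ (i + 1) * v.asIdeal ^ (k + 1)) (𝔞 * 𝔠)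
    (algClosureEmb ι ((xac i k : rayClassField K (𝔤 * v'.asIdeal ^ (i + 1) * v.asIdeal ^ (k + 1))) : AlgebraicClosure K)))
  (σ : absoluteGaloisGroup (v.adicCompletion K))
  (hσ : ∀ i k : ℕ, absRestrictNormalHom (rayClassField K (𝔤 * v'.asIdeal ^ (i + 1) * v.asIdeal ^ (k + 1)))
      (absGaloisRestrict K (v.adicCompletion K) σ) =
    artinSymbol (galFrob K (rayClassField K (𝔤 * v'.asIdeal ^ (i + 1) * v.asIdeal ^ (k + 1)))) 𝔞)
  -- an Amice pair `(g, s)` of `σ̃|_{E_∞}`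
  {g : PowerSeries 𝒪[v.adicCompletion K]} {s : ZMod d}
  (hg : ∀ m, ∃ a : ℕ, (∀ x : E m, σ • (x : AlgebraicClosure (v.adicCompletion K)) = (σ₀ ^ a) • (x : AlgebraicClosure (v.adicCompletion K))) ∧
    ((1 + PowerSeries.X : PowerSeries 𝒪[v.adicCompletion K]) ^ p ^ m - 1) ∣ g - (1 + PowerSeries.X) ^ a ∧ (a : ZMod d) = s)
  -- coherence certificates of the three families (free: any proof terms, e.g. the capstone's own)
  (h𝔞 : ∀ m, (ellipticUnitsPrincipal₂ h24iii h25 hK ι h𝔤0 hv hvv' hw hπ hα0 hα𝔪 hαw hαπ E hmono c (fun i ↦ hE (i + c)) hdegE h𝔞0 h𝔞c xa hxa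
    (m + 1)).baseNorm hπ (hmono (Nat.le_succ m)) =
    ellipticUnitsPrincipal₂ h24iii h25 hK ι h𝔤0 hv hvv' hw hπ hα0 hα𝔪 hαw hαπ E hmono c (fun i ↦ hE (i + c)) hdegE h𝔞0 h𝔞c xa hxa m)
  (h𝔠 : ∀ m, (ellipticUnitsPrincipal₂ h24iii h25 hK ι h𝔤0 hv hvv' hw hπ hα0 hα𝔪 hαw hαπ E hmono c (fun i ↦ hE (i + c)) hdegE h𝔠0 h𝔠c xc hxc
    (m + 1)).baseNorm hπ (hmono (Nat.le_succ m)) =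
    ellipticUnitsPrincipal₂ h24iii h25 hK ι h𝔤0 hv hvv' hw hπ hα0 hα𝔪 hαw hαπ E hmono c (fun i ↦ hE (i + c)) hdegE h𝔠0 h𝔠c xc hxc m)
  (h𝔞𝔠 : ∀ m, (ellipticUnitsPrincipal₂ h24iii h25 hK ι h𝔤0 hv hvv' hw hπ hα0 hα𝔪 hαw hαπ E hmono c (fun i ↦ hE (i + c)) hdegE
      (mul_ne_zero h𝔞0 h𝔠0) h𝔞𝔠c xac hxac (m + 1)).baseNorm hπ (hmono (Nat.le_succ m)) =
    ellipticUnitsPrincipal₂ h24iii h25 hK ι h𝔤0 hv hvv' hw hπ hα0 hα𝔪 hαw hαπ E hmono c (fun i ↦ hE (i + c)) hdegE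
      (mul_ne_zero h𝔞0 h𝔠0) h𝔞𝔠c xac hxac m)

include h24ii hσ hg in
/-- ★★ **`Col ⟨e(𝔞𝔠)⟩ = 𝒯_{σ̃_𝔞}(Col ⟨e(𝔠)⟩) + C(N𝔠) • Col ⟨e(𝔞)⟩`** in `M = M₁^{ℤ/d}` — II.2.4 (ii) for `𝔞` liftable and `𝔠` ARBITRARY, through the
two-variable Coleman transform (`𝒯_{σ̃} = galOpₗ (χ_π σ̃) g s`). [cite: deShalit1987, II.2.4 (ii), II.4.12 (29); I §3.4 Lemma (ii), §3.8 (17)] -/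
theorem colemanImage_ellipticUnitsPrincipal₂_mul_eq :
    colemanImage hd hπ E hmono hE hdeg hσ₀ hq u hu γ hθ hcoh h𝔞𝔠 =
      galOpₗ hπ hq u hu γ (lubinTateChar hπ σ) g s (colemanImage hd hπ E hmono hE hdeg hσ₀ hq u hu γ hθ hcoh h𝔠) +
        (PowerSeries.C ((Ideal.absNorm 𝔠 : ℕ) : PowerSeries 𝒪[v.adicCompletion K]) : PowerSeries (PowerSeries 𝒪[v.adicCompletion K])) •
          colemanImage hd hπ E hmono hE hdeg hσ₀ hq u hu γ hθ hcoh h𝔞 :=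
  colemanImage_eq_galOpₗ_add_smul_of_mul_pow_eq hd hπ E hmono hE hdeg hσ₀ hq u hu γ hθ hcoh h𝔠 h𝔞 h𝔞𝔠 σ hg fun j ↦
    galAct_ellipticUnitsPrincipal₂_mul_pow h24iii h25 hK ι h𝔤0 hv hvv' hw hπ hα0 hα𝔪 hαw hαπ E hmono c (fun i ↦ hE (i + c)) hdegE h𝔞0 h𝔞c
      h24ii h𝔠0 h𝔠c h𝔞𝔠c xa hxa xc hxc xac hxac σ hσ j

include h24ii hσ hg in
/-- ★★★ **`Σ Col ⟨e(𝔞𝔠)⟩ = σ_{χ_π σ̃_𝔞}(C g • Σ Col ⟨e(𝔠)⟩) + C(N𝔠) • Σ Col ⟨e(𝔞)⟩`** on the `ℤ/d`-trace (the module `N_Σ` of the (c)-capstone) —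
II.2.4 (ii) for `𝔞` liftable and `𝔠` ARBITRARY: the `𝔓`-part of a non-liftable elliptic unit `e(𝔞𝔠)` in terms of `e(𝔠)`, `e(𝔞)` and the local lift of
`σ_𝔞`. [cite: deShalit1987, II.2.4 (ii), II.4.12 (29)–(33), III.1.3; I §3.1, §3.4 Lemma (ii)] -/
theorem indexTraceₗ_colemanImage_ellipticUnitsPrincipal₂_mul_eq :
    indexTraceₗ hπ hq u hu γ (colemanImage hd hπ E hmono hE hdeg hσ₀ hq u hu γ hθ hcoh h𝔞𝔠) =
      unitTwistₗ hπ hq (intBase (v.adicCompletion K)) u hu γ (lubinTateChar hπ σ)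
          ((PowerSeries.C g : PowerSeries (PowerSeries 𝒪[v.adicCompletion K])) •
            indexTraceₗ hπ hq u hu γ (colemanImage hd hπ E hmono hE hdeg hσ₀ hq u hu γ hθ hcoh h𝔠)) +
        (PowerSeries.C ((Ideal.absNorm 𝔠 : ℕ) : PowerSeries 𝒪[v.adicCompletion K]) : PowerSeries (PowerSeries 𝒪[v.adicCompletion K])) •
          indexTraceₗ hπ hq u hu γ (colemanImage hd hπ E hmono hE hdeg hσ₀ hq u hu γ hθ hcoh h𝔞) :=
  indexTraceₗ_colemanImage_eq_of_mul_pow_eq hd hπ E hmono hE hdeg hσ₀ hq u hu γ hθ hcoh h𝔠 h𝔞 h𝔞𝔠 σ hg fun j ↦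
    galAct_ellipticUnitsPrincipal₂_mul_pow h24iii h25 hK ι h𝔤0 hv hvv' hw hπ hα0 hα𝔪 hαw hαπ E hmono c (fun i ↦ hE (i + c)) hdegE h𝔞0 h𝔞c
      h24ii h𝔠0 h𝔠c h𝔞𝔠c xa hxa xc hxc xac hxac σ hσ j

include h24ii hσ hg hε in
/-- ★★★ **`φ_ε(Σ Col ⟨e(𝔞𝔠)⟩) = (t_{χσ̃_𝔞}·C g)·φ_ε(Σ Col ⟨e(𝔠)⟩) + C(N𝔠)·φ_ε(Σ Col ⟨e(𝔞)⟩)`** on the `ε`-coinvariants (`t_v = φ_ε(σ_v 1)`): the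
Coleman functional of a non-liftable elliptic unit `e(𝔞𝔠)` from `e(𝔠)` and the liftable `e(𝔞)`.
[cite: deShalit1987, II.2.4 (ii), II.4.12 (29)–(33), III.1.4 (5); I §3.1, §3.4 Lemma (ii)] -/
theorem colemanDeltaCoinvFun_indexTraceₗ_colemanImage_ellipticUnitsPrincipal₂_mul_eq :
    colemanDeltaCoinvFun hπ hq (intBase (v.adicCompletion K)) u hu γ (eq_zero_of_C_pi_mul_eq_zero_integer hπ) w hγ ε
        (indexTraceₗ hπ hq u hu γ (colemanImage hd hπ E hmono hE hdeg hσ₀ hq u hu γ hθ hcoh h𝔞𝔠)) =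
      colemanDeltaCoinvFun hπ hq (intBase (v.adicCompletion K)) u hu γ (eq_zero_of_C_pi_mul_eq_zero_integer hπ) w hγ ε
            (unitTwistₗ hπ hq (intBase (v.adicCompletion K)) u hu γ (lubinTateChar hπ σ) (TActModule.ofPS _ _ 1)) *
          (PowerSeries.C g : PowerSeries (PowerSeries 𝒪[v.adicCompletion K])) *
          colemanDeltaCoinvFun hπ hq (intBase (v.adicCompletion K)) u hu γ (eq_zero_of_C_pi_mul_eq_zero_integer hπ) w hγ ε
            (indexTraceₗ hπ hq u hu γ (colemanImage hd hπ E hmono hE hdeg hσ₀ hq u hu γ hθ hcoh h𝔠)) +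
        (PowerSeries.C ((Ideal.absNorm 𝔠 : ℕ) : PowerSeries 𝒪[v.adicCompletion K]) : PowerSeries (PowerSeries 𝒪[v.adicCompletion K])) *
          colemanDeltaCoinvFun hπ hq (intBase (v.adicCompletion K)) u hu γ (eq_zero_of_C_pi_mul_eq_zero_integer hπ) w hγ ε
            (indexTraceₗ hπ hq u hu γ (colemanImage hd hπ E hmono hE hdeg hσ₀ hq u hu γ hθ hcoh h𝔞)) :=
  colemanDeltaCoinvFun_indexTraceₗ_colemanImage_eq_of_mul_pow_eq hd hπ E hmono hE hdeg hσ₀ hq u hu γ hθ hcoh w hγ ε hε h𝔠 h𝔞 h𝔞𝔠 σ hg fun j ↦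
    galAct_ellipticUnitsPrincipal₂_mul_pow h24iii h25 hK ι h𝔤0 hv hvv' hw hπ hα0 hα𝔪 hαw hαπ E hmono c (fun i ↦ hE (i + c)) hdegE h𝔞0 h𝔞c
      h24ii h𝔠0 h𝔠c h𝔞𝔠c xa hxa xc hxc xac hxac σ hσ j

variable (L : PowerSeries (PowerSeries 𝒪[v.adicCompletion K]))
  (hL : colemanDeltaCoinvFun hπ hq (intBase (v.adicCompletion K)) u hu γ (eq_zero_of_C_pi_mul_eq_zero_integer hπ) w hγ ε
      (indexTraceₗ hπ hq u hu γ (colemanImage hd hπ E hmono hE hdeg hσ₀ hq u hu γ hθ hcoh h𝔞)) =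
    (colemanDeltaCoinvFun hπ hq (intBase (v.adicCompletion K)) u hu γ (eq_zero_of_C_pi_mul_eq_zero_integer hπ) w hγ ε
        (unitTwistₗ hπ hq (intBase (v.adicCompletion K)) u hu γ (lubinTateChar hπ σ) (TActModule.ofPS _ _ 1)) *
        (PowerSeries.C g : PowerSeries (PowerSeries 𝒪[v.adicCompletion K])) -
      PowerSeries.C ((Ideal.absNorm 𝔞 : ℕ) : PowerSeries 𝒪[v.adicCompletion K])) * L)

include h24ii hσ hg hε hL in
/-- ★★★ **THE SECOND COSET COMPONENT FOR THE ELLIPTIC UNITS**: given the (c)-capstone's value `φ_ε(Σ Col ⟨e(𝔞)⟩) = (t_{χσ̃_𝔞}·C g − C(N𝔞))·L`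
(`hL` of T15 at the liftable `𝔞`), for every `𝔠` prime to `𝔤vv'`:
**`φ_ε(Σ Col ⟨e(𝔞𝔠)⟩) = (t_{χσ̃_𝔞}·C g)·φ_ε(Σ Col ⟨e(𝔠)⟩) + C(N𝔠)·(t_{χσ̃_𝔞}·C g − C(N𝔞))·L`** — the only datum beyond `L = L_ε` is
`φ_ε(Σ Col ⟨e(𝔠)⟩)`, de Shalit's component `μ_τ` of the semi-local measure for the coset `τ = σ_𝔠 D`.
[cite: deShalit1987, II.2.4 (ii), II.4.12 (29)–(33), III.1.3, III.1.4 (5)] -/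
theorem colemanDeltaCoinvFun_indexTraceₗ_colemanImage_ellipticUnitsPrincipal₂_mul_eq_of_eq_mul :
    colemanDeltaCoinvFun hπ hq (intBase (v.adicCompletion K)) u hu γ (eq_zero_of_C_pi_mul_eq_zero_integer hπ) w hγ ε
        (indexTraceₗ hπ hq u hu γ (colemanImage hd hπ E hmono hE hdeg hσ₀ hq u hu γ hθ hcoh h𝔞𝔠)) =
      colemanDeltaCoinvFun hπ hq (intBase (v.adicCompletion K)) u hu γ (eq_zero_of_C_pi_mul_eq_zero_integer hπ) w hγ ε
            (unitTwistₗ hπ hq (intBase (v.adicCompletion K)) u hu γ (lubinTateChar hπ σ) (TActModule.ofPS _ _ 1)) *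
          (PowerSeries.C g : PowerSeries (PowerSeries 𝒪[v.adicCompletion K])) *
          colemanDeltaCoinvFun hπ hq (intBase (v.adicCompletion K)) u hu γ (eq_zero_of_C_pi_mul_eq_zero_integer hπ) w hγ ε
            (indexTraceₗ hπ hq u hu γ (colemanImage hd hπ E hmono hE hdeg hσ₀ hq u hu γ hθ hcoh h𝔠)) +
        (PowerSeries.C ((Ideal.absNorm 𝔠 : ℕ) : PowerSeries 𝒪[v.adicCompletion K]) : PowerSeries (PowerSeries 𝒪[v.adicCompletion K])) *
          ((colemanDeltaCoinvFun hπ hq (intBase (v.adicCompletion K)) u hu γ (eq_zero_of_C_pi_mul_eq_zero_integer hπ) w hγ ε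
              (unitTwistₗ hπ hq (intBase (v.adicCompletion K)) u hu γ (lubinTateChar hπ σ) (TActModule.ofPS _ _ 1)) *
              (PowerSeries.C g : PowerSeries (PowerSeries 𝒪[v.adicCompletion K])) -
            PowerSeries.C ((Ideal.absNorm 𝔞 : ℕ) : PowerSeries 𝒪[v.adicCompletion K])) * L) :=
  colemanDeltaCoinvFun_indexTraceₗ_colemanImage_eq_of_mul_pow_eq_of_eq_mul hd hπ E hmono hE hdeg hσ₀ hq u hu γ hθ hcoh w hγ ε hε h𝔠 h𝔞 h𝔞𝔠 σ hg
    (fun j ↦ galAct_ellipticUnitsPrincipal₂_mul_pow h24iii h25 hK ι h𝔤0 hv hvv' hw hπ hα0 hα𝔪 hαw hαπ E hmono c (fun i ↦ hE (i + c)) hdegE h𝔞0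
      h𝔞c h24ii h𝔠0 h𝔠c h𝔞𝔠c xa hxa xc hxc xac hxac σ hσ j) _ L hL

include h24ii hσ hg hε hL in
/-- ★★ **The conjugate elliptic unit `(σ_𝔠 e(𝔞))_𝔓 = e(𝔞𝔠)_𝔓 · e(𝔠)_𝔓^{−N𝔞}` has Coleman functional `(t_{χσ̃_𝔞}·C g − C(N𝔞))·(C(N𝔠)·L + φ_ε(Σ Col ⟨e(𝔠)⟩))`**:
`φ_ε(Σ Col ⟨e(𝔞𝔠)⟩ − C(N𝔞) • Σ Col ⟨e(𝔠)⟩) = (t·C g − C(N𝔞))·(C(N𝔠)·L + φ_ε(Σ Col ⟨e(𝔠)⟩))` — the conjugate cocycle family has the constant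
`L′ = N𝔠·L + φ_ε(Σ Col ⟨e(𝔠)⟩)` (`LubinTateColemanCoordCoinvariantCosetTwo`). [cite: deShalit1987, II.2.4 (ii), II.4.12 (33), III.1.4 (5)] -/
theorem colemanDeltaCoinvFun_indexTraceₗ_colemanImage_ellipticUnitsPrincipal₂_sub_smul_eq :
    colemanDeltaCoinvFun hπ hq (intBase (v.adicCompletion K)) u hu γ (eq_zero_of_C_pi_mul_eq_zero_integer hπ) w hγ ε
        (indexTraceₗ hπ hq u hu γ (colemanImage hd hπ E hmono hE hdeg hσ₀ hq u hu γ hθ hcoh h𝔞𝔠) -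
          (PowerSeries.C ((Ideal.absNorm 𝔞 : ℕ) : PowerSeries 𝒪[v.adicCompletion K]) : PowerSeries (PowerSeries 𝒪[v.adicCompletion K])) •
            indexTraceₗ hπ hq u hu γ (colemanImage hd hπ E hmono hE hdeg hσ₀ hq u hu γ hθ hcoh h𝔠)) =
      (colemanDeltaCoinvFun hπ hq (intBase (v.adicCompletion K)) u hu γ (eq_zero_of_C_pi_mul_eq_zero_integer hπ) w hγ ε
            (unitTwistₗ hπ hq (intBase (v.adicCompletion K)) u hu γ (lubinTateChar hπ σ) (TActModule.ofPS _ _ 1)) *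
          (PowerSeries.C g : PowerSeries (PowerSeries 𝒪[v.adicCompletion K])) -
        PowerSeries.C ((Ideal.absNorm 𝔞 : ℕ) : PowerSeries 𝒪[v.adicCompletion K])) *
        ((PowerSeries.C ((Ideal.absNorm 𝔠 : ℕ) : PowerSeries 𝒪[v.adicCompletion K]) : PowerSeries (PowerSeries 𝒪[v.adicCompletion K])) * L +
          colemanDeltaCoinvFun hπ hq (intBase (v.adicCompletion K)) u hu γ (eq_zero_of_C_pi_mul_eq_zero_integer hπ) w hγ ε
            (indexTraceₗ hπ hq u hu γ (colemanImage hd hπ E hmono hE hdeg hσ₀ hq u hu γ hθ hcoh h𝔠))) :=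
  colemanDeltaCoinvFun_indexTraceₗ_colemanImage_sub_smul_eq hd hπ E hmono hE hdeg hσ₀ hq u hu γ hθ hcoh w hγ ε hε h𝔠 h𝔞 h𝔞𝔠 σ hg
    (fun j ↦ galAct_ellipticUnitsPrincipal₂_mul_pow h24iii h25 hK ι h𝔤0 hv hvv' hw hπ hα0 hα𝔪 hαw hαπ E hmono c (fun i ↦ hE (i + c)) hdegE h𝔞0
      h𝔞c h24ii h𝔠0 h𝔠c h𝔞𝔠c xa hxa xc hxc xac hxac σ hσ j) _ L hL

end Summit.BirchSwinnertonDyer.BirchSwinnertonDyer.Theorems.PrintCf2.EllipticUnitsMulRuleColeman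

end
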